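import Literature.Combinatorics.SimpleGraph.GraphLifts
import Literature.Combinatorics.Enumerative.PermPrescribed
import Mathlib.Analysis.Complex.Exponential
import Mathlib.Data.Fintype.BigOperators
import Mathlib.Algebra.BigOperators.Field
import HarnessLib

/-!
# Independent sets in random lifts: the first-moment count

Topic `Literature/Combinatorics/SimpleGraph`.  For the random-graph input of Conneryd–Ghannane–
Pang 2025, Theorem 6.1 (chromatic number of the fooling graphs; the source uses
[KPGW10, CFRR02] for `𝒢_{n,d}`, Lemma 6.2) we bound independent sets in LIFTS of a fixed base
graph `B` (`GraphLifts.lean`) by the first-moment method, COUNTING over all choices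
`π : UpEdge B → Perm (Fin a)` of edge permutations:

* `fibre T x` — the part of `T ⊆ W × Fin a` over `x`; `indepLifts T` — the lifts in which `T` is
  independent; `mem_indepLifts` — `T` is independent in `liftGraph π` iff every `π e`, `e = (x,y)`,
  maps `fibre T x` away from `fibre T y` (a PRODUCT event); hence
  `card_indepLifts = ∏_e #permsAvoiding`;
* `card_indepLifts_le` — `#indepLifts T ≤ (a!)^{|E|} · exp(-∑_e t_x t_y / a)`
  (`card_permsAvoiding_mul_le` and `1 - r/a ≤ e^{-r/a}`);
* `two_mul_sum_fibre_ge` — if every vertex of `B` is non-adjacent to at most `3` vertices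
  (itself included: `|W| ≤ deg x + 3`, true for `K_{d+1}`, `K_{d+2}` minus a matching, `K_{d+3}`
  minus a Hamilton cycle) then `2·∑_e t_x t_y ≥ t (t - 3a)` for `|T| = t`;
* **`sum_card_indepLifts_le`** — the number of pairs (lift, independent `t`-set) is at most
  `C(|W|a, t) · (a!)^{|E|} · exp(-(t² - 3at)/(2a))`.

## References

* [ConnerydGhannanePang2025] arXiv:2511.17272, Lemma 6.2 (the property needed: `χ > d/(4 log d)`).
* [folklore] first-moment method for independent sets in random regular graphs / lifts.
-/

noncomputable section

namespace Literature.Combinatorics.SimpleGraph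

open Finset Literature.Combinatorics.Enumerative

variable {W : Type*} [LinearOrder W] {B : _root_.SimpleGraph W} {a : ℕ}

/-! ### Upward edges: decidable equality and projections -/

/-- Decidable equality of upward edges. [folklore] -/
instance UpEdge.instDecidableEq : DecidableEq (UpEdge B) := by
  unfold UpEdge; infer_instance

/-- The lower endpoint of an upward edge. [folklore] -/
def UpEdge.lo (e : UpEdge B) : W := (show {p : W × W // p.1 < p.2 ∧ B.Adj p.1 p.2} from e).1.1

/-- The upper endpoint of an upward edge. [folklore] -/
def UpEdge.hi (e : UpEdge B) : W := (show {p : W × W // p.1 < p.2 ∧ B.Adj p.1 p.2} from e).1.2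

/-- `lo < hi`. [folklore] -/
theorem UpEdge.lo_lt_hi (e : UpEdge B) : e.lo < e.hi :=
  (show {p : W × W // p.1 < p.2 ∧ B.Adj p.1 p.2} from e).2.1

/-- `lo ~ hi`. [folklore] -/
theorem UpEdge.adj (e : UpEdge B) : B.Adj e.lo e.hi :=
  (show {p : W × W // p.1 < p.2 ∧ B.Adj p.1 p.2} from e).2.2

/-- Build an upward edge. [folklore] -/
def UpEdge.mk' (x y : W) (h : x < y ∧ B.Adj x y) : UpEdge B :=
  (show {p : W × W // p.1 < p.2 ∧ B.Adj p.1 p.2} from ⟨(x, y), h⟩)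

/-- Projections of `mk'`. [folklore] -/
@[simp] theorem UpEdge.lo_mk' (x y : W) (h : x < y ∧ B.Adj x y) : (UpEdge.mk' x y h).lo = x := rfl

/-- Projections of `mk'`. [folklore] -/
@[simp] theorem UpEdge.hi_mk' (x y : W) (h : x < y ∧ B.Adj x y) : (UpEdge.mk' x y h).hi = y := rfl

/-- Extensionality of upward edges through the projections. [folklore] -/
theorem UpEdge.ext' {e e' : UpEdge B} (h1 : e.lo = e'.lo) (h2 : e.hi = e'.hi) : e = e' := by
  have : (show {p : W × W // p.1 < p.2 ∧ B.Adj p.1 p.2} from e) =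
      (show {p : W × W // p.1 < p.2 ∧ B.Adj p.1 p.2} from e') :=
    Subtype.ext (Prod.ext h1 h2)
  exact this

/-- `mk'` of the projections. [folklore] -/
theorem UpEdge.mk'_lo_hi (e : UpEdge B) : UpEdge.mk' e.lo e.hi ⟨e.lo_lt_hi, e.adj⟩ = e :=
  UpEdge.ext' rfl rfl

/-- The permutation of a lift datum at an upward edge given by its endpoints. [folklore] -/
theorem liftGraph_adj_mk' (π : UpEdge B → Equiv.Perm (Fin a)) {x y : W} (h : x < y ∧ B.Adj x y)
    (i : Fin a) : (liftGraph π).Adj (x, i) (y, π (UpEdge.mk' x y h) i) :=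
  Or.inl ⟨h, rfl⟩

/-! ### Fibres of a vertex set -/

/-- The FIBRE of `T` over `x`: `{i | (x, i) ∈ T}`. [folklore] -/
def fibre (T : Finset (W × Fin a)) (x : W) : Finset (Fin a) :=
  (T.filter fun p => p.1 = x).image Prod.snd

/-- Membership in a fibre. [folklore] -/
theorem mem_fibre {T : Finset (W × Fin a)} {x : W} {i : Fin a} : i ∈ fibre T x ↔ (x, i) ∈ T := by
  unfold fibre
  rw [Finset.mem_image]
  constructor
  · rintro ⟨⟨x', i'⟩, hp, rfl⟩
    rw [Finset.mem_filter] at hp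
    obtain ⟨hp, rfl⟩ := hp
    exact hp
  · intro h
    exact ⟨(x, i), Finset.mem_filter.2 ⟨h, rfl⟩, rfl⟩

/-- A fibre has at most `a` elements. [folklore] -/
theorem card_fibre_le (T : Finset (W × Fin a)) (x : W) : (fibre T x).card ≤ a :=
  (Finset.card_le_univ _).trans (by rw [Fintype.card_fin])

variable [Fintype W]

/-- The fibres partition `T`: `∑_x |fibre T x| = |T|`. [folklore] -/
theorem sum_card_fibre (T : Finset (W × Fin a)) : ∑ x, (fibre T x).card = T.card := by
  have h : ∀ x, (fibre T x).card = (T.filter fun p => p.1 = x).card := by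
    intro x
    unfold fibre
    refine Finset.card_image_of_injOn fun p hp q hq hpq => ?_
    rw [Finset.mem_coe, Finset.mem_filter] at hp hq
    exact Prod.ext (hp.2.trans hq.2.symm) hpq
  simp_rw [h]
  rw [← Finset.card_eq_sum_card_fiberwise (t := Finset.univ) fun p _ => Finset.mem_univ p.1]

/-! ### Independence is a product event -/

variable [DecidableRel B.Adj]

/-- THE LIFTS IN WHICH `T` IS INDEPENDENT, as a product finset: for every upward edge `(x, y)` the
permutation maps `fibre T x` away from `fibre T y`. [folklore] -/
def indepLifts (T : Finset (W × Fin a)) : Finset (UpEdge B → Equiv.Perm (Fin a)) :=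
  Fintype.piFinset fun e => permsAvoiding (fibre T e.lo) (fibre T e.hi)

/-- `T` is independent in `liftGraph π` iff `π ∈ indepLifts T`. [folklore] -/
theorem mem_indepLifts {T : Finset (W × Fin a)} {π : UpEdge B → Equiv.Perm (Fin a)} :
    π ∈ indepLifts T ↔ ∀ u ∈ T, ∀ v ∈ T, ¬ (liftGraph π).Adj u v := by
  rw [indepLifts, Fintype.mem_piFinset]
  simp_rw [mem_permsAvoiding, mem_fibre]
  constructor
  · rintro h ⟨x, i⟩ hu ⟨y, j⟩ hv (⟨hxy, hij⟩ | ⟨hyx, hji⟩)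
    · refine h (UpEdge.mk' x y hxy) i (by simpa using hu) ?_
      have hij : π (UpEdge.mk' x y hxy) i = j := hij
      simpa [hij] using hv
    · refine h (UpEdge.mk' y x hyx) j (by simpa using hv) ?_
      have hji : π (UpEdge.mk' y x hyx) j = i := hji
      simpa [hji] using hu
  · intro h e i hi hmem
    exact h (e.lo, i) hi (e.hi, _) hmem (by
      have := liftGraph_adj_mk' π ⟨e.lo_lt_hi, e.adj⟩ i
      rwa [UpEdge.mk'_lo_hi] at this)

/-- `#indepLifts T = ∏_e #permsAvoiding (fibre T x) (fibre T y)`. [folklore] -/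
theorem card_indepLifts (T : Finset (W × Fin a)) :
    (indepLifts (B := B) T).card = ∏ e : UpEdge B, (permsAvoiding (fibre T e.lo) (fibre T e.hi)).card := by
  rw [indepLifts, Fintype.card_piFinset]

/-- `1 - r/a ≤ exp(-r/a)`, in the form `((a - r)/a)^s ≤ exp(-(s r)/a)`. [folklore] -/
theorem div_pow_le_exp {a r s : ℕ} (ha : 0 < a) (hr : r ≤ a) :
    (((a - r : ℕ) : ℝ) / a) ^ s ≤ Real.exp (-((s : ℝ) * r) / a) := by
  have ha' : (0 : ℝ) < a := by exact_mod_cast ha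
  have h1 : ((a - r : ℕ) : ℝ) / a = -(r : ℝ) / a + 1 := by
    rw [Nat.cast_sub hr]
    field_simp
    ring
  rw [h1, show -((s : ℝ) * r) / a = s * (-(r : ℝ) / a) by ring, Real.exp_nat_mul]
  refine pow_le_pow_left₀ ?_ (Real.add_one_le_exp _) s
  rw [← h1]
  positivity

/-- **The probability that `T` is independent**: `#indepLifts T ≤ (a!)^{|E|} exp(-∑_e t_x t_y/a)`.
[folklore] -/
theorem card_indepLifts_le (ha : 0 < a) (T : Finset (W × Fin a)) :
    ((indepLifts (B := B) T).card : ℝ) ≤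
      (a.factorial : ℝ) ^ Fintype.card (UpEdge B) *
        Real.exp (-(∑ e : UpEdge B, ((fibre T e.lo).card : ℝ) * (fibre T e.hi).card) / a) := by
  rw [card_indepLifts, Nat.cast_prod]
  have hfac : ∀ e : UpEdge B, ((permsAvoiding (fibre T e.lo) (fibre T e.hi)).card : ℝ) ≤
      a.factorial * Real.exp (-(((fibre T e.lo).card : ℝ) * (fibre T e.hi).card) / a) := by
    intro e
    set s := (fibre T e.lo).card
    set r := (fibre T e.hi).card
    have hr : r ≤ a := card_fibre_le T _
    have key := card_permsAvoiding_mul_le (fibre T e.lo) (fibre T e.hi)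
    rw [Fintype.card_fin] at key
    have key' : ((permsAvoiding (fibre T e.lo) (fibre T e.hi)).card : ℝ) * (a : ℝ) ^ s ≤
        ((a - r : ℕ) : ℝ) ^ s * a.factorial := by exact_mod_cast key
    have ha' : (0 : ℝ) < (a : ℝ) ^ s := by positivity
    calc ((permsAvoiding (fibre T e.lo) (fibre T e.hi)).card : ℝ)
        ≤ ((a - r : ℕ) : ℝ) ^ s * a.factorial / (a : ℝ) ^ s := by
          rw [le_div_iff₀ ha']; exact key'
      _ = a.factorial * ((((a - r : ℕ) : ℝ) / a) ^ s) := by rw [div_pow]; ring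
      _ ≤ a.factorial * Real.exp (-((s : ℝ) * r) / a) :=
          mul_le_mul_of_nonneg_left (div_pow_le_exp ha hr) (Nat.cast_nonneg _)
  calc ∏ e : UpEdge B, ((permsAvoiding (fibre T e.lo) (fibre T e.hi)).card : ℝ)
      ≤ ∏ e : UpEdge B, (a.factorial * Real.exp (-(((fibre T e.lo).card : ℝ) * (fibre T e.hi).card) / a)) :=
        Finset.prod_le_prod (fun e _ => Nat.cast_nonneg _) fun e _ => hfac e
    _ = (a.factorial : ℝ) ^ Fintype.card (UpEdge B) *
        Real.exp (-(∑ e : UpEdge B, ((fibre T e.lo).card : ℝ) * (fibre T e.hi).card) / a) := by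
        rw [Finset.prod_mul_distrib, Finset.prod_const, Finset.card_univ, ← Real.exp_sum]
        congr 1
        rw [neg_div, Finset.sum_div, ← Finset.sum_neg_distrib]
        refine congrArg Real.exp (Finset.sum_congr rfl fun e _ => ?_)
        rw [neg_div]

/-! ### The edge sum of the fibre sizes -/

/-- Sum over ordered adjacent pairs = twice the sum over upward edges. [folklore] -/
theorem sum_adj_eq_two_mul_sum_upEdge (f : W → W → ℝ) (hf : ∀ x y, f x y = f y x) :
    ∑ x, ∑ y ∈ B.neighborFinset x, f x y = 2 * ∑ e : UpEdge B, f e.lo e.hi := by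
  classical
  -- split the ordered pairs into `x < y` and `y < x`
  have hsplit : ∀ x, ∑ y ∈ B.neighborFinset x, f x y =
      ∑ y ∈ (B.neighborFinset x).filter (fun y => x < y), f x y +
        ∑ y ∈ (B.neighborFinset x).filter (fun y => y < x), f x y := by
    intro x
    rw [← Finset.sum_union]
    · refine Finset.sum_congr ?_ fun _ _ => rfl
      ext y
      simp only [Finset.mem_union, Finset.mem_filter, _root_.SimpleGraph.mem_neighborFinset]
      constructor
      · intro h
        rcases lt_trichotomy x y with hlt | rfl | hgt
        · exact Or.inl ⟨h, hlt⟩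
        · exact absurd h (B.loopless.irrefl _)
        · exact Or.inr ⟨h, hgt⟩
      · rintro (⟨h, -⟩ | ⟨h, -⟩) <;> exact h
    · rw [Finset.disjoint_left]
      intro y hy hy'
      exact lt_asymm (Finset.mem_filter.1 hy).2 (Finset.mem_filter.1 hy').2
  simp_rw [hsplit]
  rw [Finset.sum_add_distrib]
  -- both halves equal the sum over upward edges
  have hup : ∑ x, ∑ y ∈ (B.neighborFinset x).filter (fun y => x < y), f x y =
      ∑ e : UpEdge B, f e.lo e.hi := by
    rw [Finset.sum_sigma']
    refine Finset.sum_bij (fun p hp => UpEdge.mk' p.1 p.2 ?_) (fun _ _ => Finset.mem_univ _)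
      (fun p hp q hq h => ?_) (fun e _ => ?_) (fun _ _ => by simp)
    · have h := (Finset.mem_sigma.1 hp).2
      rw [Finset.mem_filter, _root_.SimpleGraph.mem_neighborFinset] at h
      exact ⟨h.2, h.1⟩
    · have h1 := congrArg UpEdge.lo h
      have h2 := congrArg UpEdge.hi h
      simp only [UpEdge.lo_mk', UpEdge.hi_mk'] at h1 h2
      exact Sigma.ext h1 (heq_of_eq h2)
    · refine ⟨⟨e.lo, e.hi⟩, Finset.mem_sigma.2 ⟨Finset.mem_univ _, Finset.mem_filter.2
        ⟨(B.mem_neighborFinset _ _).2 e.adj, e.lo_lt_hi⟩⟩, (UpEdge.mk'_lo_hi e)⟩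
  have hdown : ∑ x, ∑ y ∈ (B.neighborFinset x).filter (fun y => y < x), f x y =
      ∑ e : UpEdge B, f e.lo e.hi := by
    rw [Finset.sum_sigma']
    refine Finset.sum_bij (fun p hp => UpEdge.mk' p.2 p.1 ?_) (fun _ _ => Finset.mem_univ _)
      (fun p hp q hq h => ?_) (fun e _ => ?_) (fun p _ => by simpa using hf _ _)
    · have h := (Finset.mem_sigma.1 hp).2
      rw [Finset.mem_filter, _root_.SimpleGraph.mem_neighborFinset] at h
      exact ⟨h.2, h.1.symm⟩
    · have h1 := congrArg UpEdge.lo h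
      have h2 := congrArg UpEdge.hi h
      simp only [UpEdge.lo_mk', UpEdge.hi_mk'] at h1 h2
      exact Sigma.ext h2 (heq_of_eq h1)
    · refine ⟨⟨e.hi, e.lo⟩, Finset.mem_sigma.2 ⟨Finset.mem_univ _, Finset.mem_filter.2
        ⟨(B.mem_neighborFinset _ _).2 e.adj.symm, e.lo_lt_hi⟩⟩, (UpEdge.mk'_lo_hi e)⟩
  rw [hup, hdown, two_mul]

/-- **Edge sum of the fibre sizes**: if every vertex of `B` is non-adjacent to at most `3`
vertices (itself included), then `2 ∑_e t_x t_y ≥ t(t - 3a)` for `|T| = t`. [folklore] -/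
theorem two_mul_sum_fibre_ge (hB : ∀ x, Fintype.card W ≤ B.degree x + 3) (T : Finset (W × Fin a)) :
    (T.card : ℝ) * (T.card - 3 * a) ≤
      2 * ∑ e : UpEdge B, ((fibre T e.lo).card : ℝ) * (fibre T e.hi).card := by
  classical
  rw [← sum_adj_eq_two_mul_sum_upEdge (fun x y => ((fibre T x).card : ℝ) * (fibre T y).card)
    fun x y => mul_comm _ _]
  -- for each `x`: `∑_{y ~ x} t_y ≥ t - 3a`
  have hx : ∀ x, ((T.card : ℝ) - 3 * a) ≤ ∑ y ∈ B.neighborFinset x, ((fibre T y).card : ℝ) := by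
    intro x
    have htot : ∑ y, ((fibre T y).card : ℝ) = T.card := by exact_mod_cast sum_card_fibre T
    have hsplit := Finset.sum_add_sum_compl (B.neighborFinset x) fun y => ((fibre T y).card : ℝ)
    have hcompl : ∑ y ∈ (B.neighborFinset x)ᶜ, ((fibre T y).card : ℝ) ≤ 3 * a := by
      calc ∑ y ∈ (B.neighborFinset x)ᶜ, ((fibre T y).card : ℝ)
          ≤ ∑ _y ∈ (B.neighborFinset x)ᶜ, (a : ℝ) :=
            Finset.sum_le_sum fun y _ => by exact_mod_cast card_fibre_le T y
        _ = ((B.neighborFinset x)ᶜ.card : ℝ) * a := by rw [Finset.sum_const, nsmul_eq_mul]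
        _ ≤ 3 * a := by
            gcongr
            have := hB x
            rw [Finset.card_compl, _root_.SimpleGraph.card_neighborFinset_eq_degree]
            exact_mod_cast (by omega : Fintype.card W - B.degree x ≤ 3)
    linarith
  calc (T.card : ℝ) * (T.card - 3 * a) = ∑ x, ((fibre T x).card : ℝ) * (T.card - 3 * a) := by
        rw [← Finset.sum_mul]; exact_mod_cast congrArg (fun n : ℕ => (n : ℝ) * ((T.card : ℝ) - 3 * a))
          (sum_card_fibre T).symm
    _ ≤ ∑ x, ((fibre T x).card : ℝ) * ∑ y ∈ B.neighborFinset x, ((fibre T y).card : ℝ) :=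
        Finset.sum_le_sum fun x _ => mul_le_mul_of_nonneg_left (hx x) (Nat.cast_nonneg _)
    _ = ∑ x, ∑ y ∈ B.neighborFinset x, ((fibre T x).card : ℝ) * (fibre T y).card := by
        refine Finset.sum_congr rfl fun x _ => ?_
        rw [Finset.mul_sum]

/-! ### The first-moment count -/

/-- **First moment for independent `t`-sets in random lifts**: the number of pairs
(lift, independent `t`-set) is at most `C(|W|·a, t) · (a!)^{|E|} · exp(-(t² - 3at)/(2a))`,
provided every vertex of `B` is non-adjacent to at most `3` vertices. [folklore] -/
theorem sum_card_indepLifts_le (ha : 0 < a) (hB : ∀ x, Fintype.card W ≤ B.degree x + 3) (t : ℕ) :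
    ∑ T ∈ (Finset.univ : Finset (W × Fin a)).powersetCard t, ((indepLifts (B := B) T).card : ℝ) ≤
      ((Fintype.card W * a).choose t : ℝ) * (a.factorial : ℝ) ^ Fintype.card (UpEdge B) *
        Real.exp (-((t : ℝ) ^ 2 - 3 * a * t) / (2 * a)) := by
  have ha' : (0 : ℝ) < a := by exact_mod_cast ha
  have hterm : ∀ T ∈ (Finset.univ : Finset (W × Fin a)).powersetCard t,
      ((indepLifts (B := B) T).card : ℝ) ≤ (a.factorial : ℝ) ^ Fintype.card (UpEdge B) *
        Real.exp (-((t : ℝ) ^ 2 - 3 * a * t) / (2 * a)) := by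
    intro T hT
    have hTt : T.card = t := (Finset.mem_powersetCard.1 hT).2
    refine (card_indepLifts_le ha T).trans (mul_le_mul_of_nonneg_left ?_ (by positivity))
    rw [Real.exp_le_exp]
    have h2 := two_mul_sum_fibre_ge hB T
    rw [hTt] at h2
    rw [div_le_div_iff₀ ha' (by positivity)]
    nlinarith
  calc ∑ T ∈ (Finset.univ : Finset (W × Fin a)).powersetCard t, ((indepLifts (B := B) T).card : ℝ)
      ≤ ∑ _T ∈ (Finset.univ : Finset (W × Fin a)).powersetCard t,
          (a.factorial : ℝ) ^ Fintype.card (UpEdge B) * Real.exp (-((t : ℝ) ^ 2 - 3 * a * t) / (2 * a)) :=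
        Finset.sum_le_sum hterm
    _ = ((Fintype.card W * a).choose t : ℝ) * (a.factorial : ℝ) ^ Fintype.card (UpEdge B) *
          Real.exp (-((t : ℝ) ^ 2 - 3 * a * t) / (2 * a)) := by
        rw [Finset.sum_const, Finset.card_powersetCard, Finset.card_univ, Fintype.card_prod,
          Fintype.card_fin, nsmul_eq_mul]
        ring

end Literature.Combinatorics.SimpleGraph
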